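import Literature.NumberTheory.EllipticCurves.CastellaGrossiLeeSkinner2022.BDPValueAtTrivialCharacter
import Summits.BirchSwinnertonDyer.Rank1Residual.Partition.AnticyclotomicControlPublishedPlaces
import Summits.BirchSwinnertonDyer.Rank1Residual.Partition.MainConjecturesEisensteinFactsDerived
import Summits.BirchSwinnertonDyer.Rank1Residual.Partition.MainConjecturesAnticyclotomicGood
import Literature.NumberTheory.EllipticCurves.BSDQuadraticDescentTorsionOddPartProofs
import Literature.NumberTheory.EllipticCurves.CuspFormLFunctionLevelConductorProofs
import HarnessLib

/-!
# Row C6 at MAIN-CONJECTURE level, completed: display (5.5) of Castella–Grossi–Lee–Skinner 2022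
# (registry A157) DERIVED in the kernel from the three numbered theorems it is printed from —
# Thm. 4.2.2 ∘ Thm. 5.1.3 at the trivial character (NEW Literature fact, session 6), Thm. 5.1.1
# (A170) — and the published Heegner-point facts; hence A149 / A47 / A52 from main conjectures only

HONEST FRAMING (cell `b2b-bsdres`, run/shared/lean/b2b/bsd-rank1-residual/; verbatim): the goal is to
DELETE the COMBINATION-SHAPED residual classes for ALL analytic-rank `≤ 1` curves over `ℚ` — "full BSD
formula for every rank `≤ 1` curve in class `C`" assembled STRICTLY from published theorems — so
that the rank-`≤ 1` remainder becomes exactly the CONSTRUCTION-SHAPED classes, which are TYPED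
(missing-input `Prop`s), NOT attempted; this is not "finishing BSD". NEW WORK of the cell (bookkeeping
over decls already in the tree), hence under `Summits/`; NO definition, NO named fact, nothing about
any particular curve asserted; no label moves (row C6 is COVERED [PUB]). Unit `b2b-bsdres-lit-cgls`
(off-peak literature typer: Castella–Grossi–Lee–Skinner 2022 / Greenberg–Vatsal 2000), session 6 —
sized ask S1b of `HOME/b2b-bsdres-lit-cgls/CGLS-GV-TYPING.md` §6 / §12.11.

## What this file does

CGLS 2022 prove their Thm. 5.3.1 (= Thm. F, the `p`-part of BSD in rank one at a good Eisenstein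
`p`) through display (5.5), "`ord_p #Ш(E/K) = 2·ord_p(c_E⁻¹ u_K⁻¹ [E(K):ℤP_K]) − Σ_w ord_p c_w(E/K)`",
which the cell typed as the named fact A157 (`display55_sha_heegnerIndex`) and on which sessions 3–5
hung the whole reducible good-`p` column (A149 = (5.7) `display57_of_display55`; A47 = CGS 2025
Thm. D `RowC6.cgsThmD_of_display55_of_cgsThmA`; A52 = CGLS Thm. F
`RowC6.cglsThmF_of_display55_of_gvThm13`; STEP L / the Heegner-index identity of row C6). The paper
obtains (5.5) from: Thm. 4.2.2 (the anticyclotomic Iwasawa–Greenberg main conjecture for `𝔛_E`,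
PROVED there) via (5.4) "`𝓕_E(0) = u·𝓛_E(0)`"; Thm. 5.1.3 (the BDP formula
`𝓛_E(0) = c_E⁻²(1 − a_p p⁻¹ + p⁻¹)² log_{ω_E}(P_K)²`); Thm. 5.1.1 (anticyclotomic control, with
`P = P_K`); and Gross–Zagier + Kolyvagin (`rank_ℤ E(K) = 1`, `#Ш(E/K) < ∞`, `P_K` non-torsion). All of
these are now Literature named facts ON THE SAME MODULE `𝔛_E = AcSelmer.XAc (E_K) p κ v̄ ∅ γ`:
`display54_thm513_generator_constantCoeff` (NEW, `CastellaGrossiLeeSkinner2022/BDPValueAtTrivialCharacter.lean`)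
and `thm511_anticyclotomicControl` (A170). This file carries out the printed derivation:

* §1 `display55_at_of_display54_of_thm511` — at ONE datum `(ι, v, v̄, κ, γ; Dt, H, ιC, P = P_K)`:
  the two generators' `ord_p 𝓕(0)` are the same number (`valuation_constantCoeff_eq_of_span_singleton_eq`),
  so `ord_p #Ш(E/K)[p^∞] + 2((ord_p(1−a_p+p) − 1 + ord_p log P_K) − ord_p[E(K):ℤP_K]) + ord_p ∏_w c_w`
  `= 2(ord_p(1−a_p+p) − 1 + ord_p log P_K) − 2 ord_p c_E`: THE ANOMALY FACTOR AND THE LOGARITHM CANCEL,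
  leaving (5.5) (`u_K = 1`; `ord_p #Ш = ord_p #Ш[p^∞]` for the finite `Ш(E/K)`). Hypotheses of
  Thm. 5.1.1 fed as in session 5: `E(ℚ_p)[p] = 0` from `a_p ≢ 1` (`LocalTorsion…`), (Sel) from
  `rank E(K) = 1 ∧ #Ш(E/K)[p^∞] < ∞` (the corank THEOREM `selmerCorank_eq_mordellWeilRank_add_holds`).
* §2 **`display55_of_display54_of_thm511 : display54_thm513_generator_constantCoeff →
  thm511_anticyclotomicControl → exists_isNewformOf → (∀ gross_zagier) →
  rank_eq_analyticRank_of_analyticRank_le_one → display55_sha_heegnerIndex`** — A157 as a THEOREM: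
  the anticyclotomic datum is PRODUCED (`exists_anticyclotomic_generator_degreeOnePrime`, THE embedding
  `embAt` at a degree-one prime, `inducedPlace`, `exists_other_prime` — sessions 5 / lit-glue / multr1),
  the level of the parametrisation is the conductor (`IsNewformOf.level_eq_conductorNorm_of_exists_isNewformOf`,
  modularity), `rank E(K) = 1` by GZK for `E` and `E^{d_K}` (`mordellWeilRank_baseChange_eq_one_and_finite_sha_of_twist_L_one_ne_zero`),
  `P_K` non-torsion by Gross–Zagier (`not_isOfFinAddOrder_of_heegner_of_analyticRank_eq_one`).
* §3 registry consequences, every binder a MAIN-CONJECTURE-level or generic published fact: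
  `display57_of_display54_of_thm511` (A149), `RowC6.cgsThmD_of_mainConjectures` (A47 LITERALLY from
  A142 = CGS Thm. A + NEW + A170 + generic facts), `RowC6.cglsThmF_of_mainConjectures` (A52 LITERALLY
  from GV Thm. 1.3 + NEW + A170 + generic facts), `RowC6.bsdp_of_mainConjectures` (`BSD(E,p)` for every
  `r_an ≤ 1` curve at every good non-anomalous Eisenstein `p > 2`).
* §4 `X11b.imcWaldspurgerOnTreeGoodAt_of_display54_of_thm511` — lit-glue's typed link (IMC∘BDP)ᵍ at `𝟙`
  (`IMCWaldspurgerOnTreeGoodAt p κ v̄ γ ι P_K`) HOLDS — published — at a good non-anomalous Eisenstein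
  `p` and a parametrisation with `p ∤ c_E` (the Manin term vanishes), through the defeq bridge of
  session 5; like `controlOnTreeGoodAt_of_thm511` it delivers the link with CGLS's convention (log at
  the prime `v` induced by `ι`, `𝔛_E` strict at `v̄ ≠ v`; reading note `CGLS-CTL-log-prime`).

After this file the reducible good-`p` column of the cell rests on exactly: CGS 2025 Thm. A (A142) /
GV 2000 Thm. 1.3 (cyclotomic main conjectures), CGLS 2022 Thm. 4.2.2 ∘ 5.1.3 (NEW) and Thm. 5.1.1
(A170) (anticyclotomic main conjecture + BDP formula + control), and generic published facts
(modularity, Gross–Zagier, Kolyvagin, GZK, Greenberg Thm. 4.1, Hoffstein–Luo) — "main-conjecture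
inputs typed as statements", the brief's goal for this source; A157 may be carried RETIRED-DERIVED
like A149 (no consumer needs `h55` as a binder of record any more).

References: [CastellaGrossiLeeSkinner2022] Thm. 4.2.2, Thm. 5.1.1, Thm. 5.1.3, proof of Thm. 5.3.1
((5.4)–(5.7)) (arXiv:2008.02571v2 TeX L2332–L2357, L2403–L2429, L2463–L2481, L2616–L2667);
[CastellaGrossiSkinner2025] Thm. A, Thm. D and its proof, Thm. 5.5.3; [GreenbergVatsal2000] Thm. (1.3);
[GrossZagier1986] I.(6.5), V.§2; [Gross1991] Thm. 1.3; [Kolyvagin1990] Thm. A;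
HOME/CITED-FACTS.md A47, A52, A142, A149, A157, A170; HOME/b2b-bsdres-lit-cgls/CGLS-GV-TYPING.md §13.
-/

noncomputable section

open scoped Classical

open WeierstrassCurve NumberField IsDedekindDomain Literature.NumberTheory.EllipticCurves
  Literature.NumberTheory.EllipticCurves.ModularForms Literature.NumberTheory.QuadraticFields
  Literature.NumberTheory.EllipticCurves.Rank1Residual
  Literature.NumberTheory.EllipticCurves.CastellaGrossiLeeSkinner2022
  Literature.NumberTheory.EllipticCurves.Castella2018

namespace Summit.BirchSwinnertonDyer.Rank1Residual

/-! ### §1 (5.5) at one datum from (5.4) ∘ Thm. 5.1.3 and Thm. 5.1.1 -/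

section Datum

variable {W : WeierstrassCurve ℚ} [W.IsElliptic] [W.IsGloballyMinimal] {p : ℕ} [Fact p.Prime]
  {K : Type} [Field K] [NumberField K]

/-- **Display (5.5) at one datum, as printed**: "Theorem 5.1.1 applies with `P = P_K`, which combined
with Theorem 5.1.3 and the relations (eq:comparison) and (5.4) yields the equality (5.5)
`ord_p(#Ш(E/K)) = 2 ord_p(c_E⁻¹ u_K⁻¹·[E(K):ℤ.P_K]) − Σ_{w∈S} ord_p(c_w(E/K))`." Inputs: the NEW fact
`h54` ((5.4) ∘ Thm. 5.1.3: a generator `𝓕` of `char_Λ(𝔛_E)` has `ord_p 𝓕(0) = 2(ord_p(1−a_p+p) − 1 +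
ord_p log_{ω_E} P_K) − 2 ord_p c_E` once `𝓕(0) ≠ 0`) and A170 `h511` (Thm. 5.1.1 at `P = P_K`: a
generator `𝓕'` with `𝓕'(0) ≠ 0` and `ord_p 𝓕'(0) = ord_p #Ш(E/K)[p^∞] + 2((ord_p(1−a_p+p) − 1 + ord_p
log_{ω_E} P_K) − ord_p[E(K):ℤP_K]) + ord_p ∏_w c_w(E/K)`); the two agree
(`valuation_generator_constantCoeff_of_display54` at `𝓕'`), the anomaly factor and the logarithm cancel,
and `ord_p #Ш(E/K)[p^∞] = ord_p #Ш(E/K)` for the finite `Ш(E/K)` (`natCard_primaryComponent_eq_pow_padicValNat`).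
Hypotheses of Thm. 5.1.1: `E(ℚ_p)[p] = 0` from `a_p ≢ 1 (mod p)` (`X11b.LocalTorsion.…_of_not_anom`);
`rank_ℤ E(K) = 1` (`hrk`), `Ш(E/K)` finite (`hfin`), `P` non-torsion (`hPinf`) carried; (Sel) of
Thm. 4.2.2 from them by the corank THEOREM. [cite: CastellaGrossiLeeSkinner2022, proof of Thm. 5.3.1, (5.4)–(5.5) (arXiv v2 TeX L2616–L2634), Thm. 4.2.2, Thm. 5.1.1, Thm. 5.1.3] -/
theorem display55_at_of_display54_of_thm511 (h54 : display54_thm513_generator_constantCoeff)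
    (h511 : thm511_anticyclotomicControl) (hp : 2 < p) (hgood : Good W p) (hred : Red W p)
    (hna : ¬ Anom W p) (hK : IsImaginaryQuadratic K) (hodd : Odd (NumberField.discr K))
    (h3 : NumberField.discr K ≠ -3) (hHN : SatisfiesHeegnerHypothesis (W.conductorNorm ℤ) K)
    (hHp : SatisfiesHeegnerHypothesis p K) (ι : K →+* ℚ_[p]) (v vbar : HeightOneSpectrum (𝓞 K))
    (hv : ∀ x : 𝓞 K, x ∈ v.asIdeal ↔ ‖ι (x : K)‖ < 1)
    (hvbar : ((p : ℕ) : 𝓞 K) ∈ vbar.asIdeal) (hne : vbar ≠ v)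
    (κ : ZpExtension K p) (hκ : κ.IsAnticyclotomic)
    (γ : Field.absoluteGaloisGroup K) [Fact (κ.IsTopGenerator γ)]
    {N : ℕ} [NeZero N] (Dt : ModularParametrizationData W N)
    (H : HeegnerDatum N (NumberField.discr K)) (ιC : K →+* ℂ) (P : (W.baseChange K).toAffine.Point)
    (hP : WeierstrassCurve.Affine.Point.map ιC.toRatAlgHom P = heegnerPointComplex Dt H)
    (hrk : (W.baseChange K).mordellWeilRank = 1) (hfin : Finite (W.baseChange K).sha)
    (hPinf : ¬ IsOfFinAddOrder P) :
    (padicValNat p (W.baseChange K).shaOrder : ℤ) =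
      2 * ((padicValNat p (AddSubgroup.zmultiples P).index : ℤ) - (padicValInt p Dt.c : ℤ)) -
        (padicValNat p (W.baseChange K).tamagawaProduct : ℤ) := by
  haveI hfinp : Finite (AddCommGroup.primaryComponent (W.baseChange K).sha p) := inferInstance
  -- (Sel) from rank 1 and finite `Ш[p^∞]`, by the corank theorem
  have hshaK : (W.baseChange K).shaCorank p = 0 :=
    (finite_primaryComponent_sha_iff_shaCorank_eq_zero (W.baseChange K) p).mp hfinp
  have hSel : (W.baseChange K).selmerCorank p = 1 := by
    rw [(W.baseChange K).selmerCorank_eq_mordellWeilRank_add_holds p, hrk, hshaK]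
  -- `E(ℚ_p)[p] = 0` at the non-anomalous good `p ≥ 3`
  have hEp : ∀ Q : (W.baseChange ℚ_[p]).toAffine.Point, p • Q = 0 → Q = 0 :=
    X11b.LocalTorsion.localTorsion_eq_zero_of_good_of_not_anom W p (by omega) hgood hred hna
  -- Thm. 5.1.1 at `P = P_K`
  obtain ⟨-, F, hF, hF0, h511v⟩ := h511 W p hp (goodOrd_of_red_of_good W p hp hgood hred) K hK hHp hHN
    ι v vbar hv hvbar hne κ hκ γ hEp hrk hfinp P hPinf
  -- (5.4) ∘ Thm. 5.1.3 for the same generator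
  have h54v := valuation_generator_constantCoeff_of_display54 h54 hp hgood hred hna K hK hHN hHp hodd h3
    hSel ι v vbar hv hvbar hne κ hκ γ Dt H ιC P hP F hF hF0
  -- `ord_p #Ш[p^∞] = ord_p #Ш`
  have hsha : padicValNat p (Nat.card (AddCommGroup.primaryComponent (W.baseChange K).sha p)) =
      padicValNat p (W.baseChange K).shaOrder := by
    rw [natCard_primaryComponent_eq_pow_padicValNat p, padicValNat.prime_pow]
    rfl
  rw [h54v, hsha] at h511v
  omega

end Datum

/-! ### §2 A157 = display (5.5) as a THEOREM -/

/-- **Display (5.5) of CGLS 2022 (registry A157, `display55_sha_heegnerIndex`) DERIVED** from the NEW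
fact (Thm. 4.2.2 ∘ Thm. 5.1.3 at `𝟙`), A170 (Thm. 5.1.1), modularity (`exists_isNewformOf`: entire
`L`-functions and level = conductor), Gross–Zagier (`gross_zagier`, the Heegner point is non-torsion
at `r_an(E) = 1`, `L(E^{d_K},1) ≠ 0`) and Gross–Zagier–Kolyvagin over `ℚ` (`hGZK`, for `E` and
`E^{d_K}`: `rank_ℤ E(K) = 1`). At each datum of A157 the anticyclotomic datum of Thm. 5.1.1 /
Thm. 4.2.2 is PRODUCED: an anticyclotomic `κ` with a topological generator `γ` and a degree-one prime
`𝔭 ∋ p` (`X11b.exists_anticyclotomic_generator_degreeOnePrime`), THE embedding `ι = embAt K p 𝔭`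
(`K ↪ K_𝔭 = ℚ_p`), `v = inducedPlace ι` (the prime induced by `ι`), `v̄ ≠ v` above `p`
(`X11b.exists_other_prime`, (spl)); `D_K ≠ −3` from `D_K < −4`. For the registry: every consumer of
A157 is a consumer of (NEW, A170) + these published facts; A157 may be carried RETIRED-DERIVED.
[cite: CastellaGrossiLeeSkinner2022, proof of Thm. 5.3.1 ((5.4)–(5.5)), Thm. 4.2.2, Thm. 5.1.1, Thm. 5.1.3]
[cite: GrossZagier1986, I.(6.5), V.§2] [cite: Gross1991, Thm. 1.3] -/
theorem display55_of_display54_of_thm511 (h54 : display54_thm513_generator_constantCoeff)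
    (h511 : thm511_anticyclotomicControl) (hnf : exists_isNewformOf)
    (hGZ : ∀ (N : ℕ) [NeZero N] (W : WeierstrassCurve ℚ) (K : Type) [Field K] [NumberField K],
      gross_zagier N W K)
    (hGZK : rank_eq_analyticRank_of_analyticRank_le_one) : display55_sha_heegnerIndex := by
  intro W _ _ p _ hp hgood hred hna hr K _ _ hK hodd hlt hHN hHp hLK N _ Dt H ιC P hP hfin
  have hmod : hasEntireLFunction_rat := WeierstrassCurve.hasEntireLFunction_rat_of_exists_isNewformOf hnf
  -- the level of the parametrisation is the conductor
  have hN : N = W.conductorNorm ℤ :=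
    IsNewformOf.level_eq_conductorNorm_of_exists_isNewformOf hnf Dt.isNewformOf
  have hHN' : SatisfiesHeegnerHypothesis N K := by rw [hN]; exact hHN
  -- `rank_ℤ E(K) = 1` by GZK for `E` and `E^{d_K}`
  obtain ⟨hrQ, hShaQ⟩ := hGZK W hr.le
  rw [hr] at hrQ
  obtain ⟨hrk, -⟩ :=
    mordellWeilRank_baseChange_eq_one_and_finite_sha_of_twist_L_one_ne_zero hGZK W K hK p hrQ hShaQ hLK
  -- the Heegner point is non-torsion
  have hPinf : ¬ IsOfFinAddOrder P :=
    X11b.not_isOfFinAddOrder_of_heegner_of_analyticRank_eq_one W N K Dt H ιC P (hGZ N W K) hmod hr hK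
      hHN' hLK hP
  -- the anticyclotomic datum: `κ, γ`, a degree-one `𝔭 ∋ p`, THE embedding at `𝔭`, `v`, `v̄`
  obtain ⟨κ, γ, 𝔭, hκ, hγ, h𝔭, he, hf⟩ := X11b.exists_anticyclotomic_generator_degreeOnePrime p K hK hHp
  haveI : Fact (κ.IsTopGenerator γ) := ⟨hγ⟩
  obtain ⟨vbar, hvbar, hne⟩ := X11b.exists_other_prime hHp (X11b.inducedPlace (X11b.embAt K p 𝔭 h𝔭 he hf))
    (X11b.natCast_mem_inducedPlace _)
  exact display55_at_of_display54_of_thm511 h54 h511 hp hgood hred hna hK hodd (by omega) hHN hHp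
    (X11b.embAt K p 𝔭 h𝔭 he hf) (X11b.inducedPlace (X11b.embAt K p 𝔭 h𝔭 he hf)) vbar
    (X11b.mem_inducedPlace_iff _) hvbar hne κ hκ γ Dt H ιC P hP hrk hfin hPinf

/-! ### §3 Registry consequences: A149, A47, A52 and `BSD(E,p)` from main-conjecture-level facts only -/

/-- **A149 = display (5.7) from the main conjectures**: `display57_of_display55'` (session 4) fed by
§2. Inputs: NEW + A170 + modularity (both spellings) + Gross–Zagier + Kolyvagin + GZK.
[cite: CastellaGrossiLeeSkinner2022, proof of Thm. 5.3.1, "combining (5.5) and (5.6) we arrive at (5.7)"] -/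
theorem display57_of_display54_of_thm511 (h54 : display54_thm513_generator_constantCoeff)
    (h511 : thm511_anticyclotomicControl) (hmodP : nonempty_modularParametrizationData)
    (hnf : exists_isNewformOf)
    (hGZ : ∀ (N : ℕ) [NeZero N] (W : WeierstrassCurve ℚ) (K : Type) [Field K] [NumberField K],
      gross_zagier N W K)
    (hKo : ∀ (N : ℕ) [NeZero N] (W : WeierstrassCurve ℚ) (K : Type) [Field K] [NumberField K],
      kolyvagin N W K)
    (hGZK : rank_eq_analyticRank_of_analyticRank_le_one) : display57_rankOne_twist :=
  display57_of_display55' (display55_of_display54_of_thm511 h54 h511 hnf hGZ hGZK) hmodP hnf hGZ hKo hGZK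

/-- **A47 derived from main conjectures: Castella–Grossi–Skinner 2025 Thm. D, in its LITERAL typed
form `thmD_padicValRat_bsd_rank_le_one`, from CGS Thm. A (A142, Mazur's main conjecture), CGLS
Thm. 4.2.2 ∘ 5.1.3 (NEW) and Thm. 5.1.1 (A170), and the generic published facts** Greenberg Thm. 4.1,
modularity (both spellings), Hoffstein–Luo, Gross–Zagier (both currencies), Kolyvagin, GZK — the
printed proof of Thm. D end to end (`RowC6.cgsThmD_of_display55_of_cgsThmA`, session 4, with its A157
binder discharged by §2). [cite: CastellaGrossiSkinner2025, Thm. D (= "Thm. 4") and its proof (§0.3 p. 5), Theorem A]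
[cite: CastellaGrossiLeeSkinner2022, Thm. 4.2.2, Thm. 5.1.1, Thm. 5.1.3, proof of Thm. 5.3.1 (5.4)–(5.7)] -/
theorem RowC6.cgsThmD_of_mainConjectures (h54 : display54_thm513_generator_constantCoeff)
    (h511 : thm511_anticyclotomicControl)
    (hA : CastellaGrossiSkinner2025.thmA_charIdeal_eq_padicLFunction)
    (hGr : greenberg_charValue_rankZero) (hmodP : nonempty_modularParametrizationData)
    (hnf : exists_isNewformOf) (hHL : HoffsteinLuo1997_exists_twist_L_one_ne_zero)
    (hGZQ : GrossZagier1986_thm_I_7_3)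
    (hGZ : ∀ (N : ℕ) [NeZero N] (W : WeierstrassCurve ℚ) (K : Type) [Field K] [NumberField K],
      gross_zagier N W K)
    (hKo : ∀ (N : ℕ) [NeZero N] (W : WeierstrassCurve ℚ) (K : Type) [Field K] [NumberField K],
      kolyvagin N W K)
    (hGZK : rank_eq_analyticRank_of_analyticRank_le_one) :
    CastellaGrossiSkinner2025.thmD_padicValRat_bsd_rank_le_one :=
  RowC6.cgsThmD_of_display55_of_cgsThmA (display55_of_display54_of_thm511 h54 h511 hnf hGZ hGZK) hA hGr
    hmodP hnf hHL hGZQ hGZ hKo hGZK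

/-- **A52 derived from main conjectures: Castella–Grossi–Lee–Skinner 2022 Thm. F (= Thm. 5.3.1), in
its LITERAL typed form `thmF_padicValRat_bsd_rank_one`, from Greenberg–Vatsal 2000 Thm. 1.3 (`hGV`),
CGLS Thm. 4.2.2 ∘ 5.1.3 (NEW) and Thm. 5.1.1 (A170), and the generic published facts** — the printed
proof end to end (`RowC6.cglsThmF_of_display55_of_gvThm13`, session 4, with its A157 binder discharged
by §2); NO Castella–Grossi–Skinner 2025 input.
[cite: CastellaGrossiLeeSkinner2022, Theorem F = Thm. 5.3.1 and its proof ((5.4)–(5.7), last paragraph), Thm. 4.2.2, Thm. 5.1.1, Thm. 5.1.3]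
[cite: GreenbergVatsal2000, Thm. (1.3)] -/
theorem RowC6.cglsThmF_of_mainConjectures (h54 : display54_thm513_generator_constantCoeff)
    (h511 : thm511_anticyclotomicControl) (hGV : GreenbergVatsal2000.thm13_charIdeal_eq_of_gvPar)
    (hGr : greenberg_charValue_rankZero) (hmodP : nonempty_modularParametrizationData)
    (hnf : exists_isNewformOf) (hHL : HoffsteinLuo1997_exists_twist_L_one_ne_zero)
    (hGZQ : GrossZagier1986_thm_I_7_3)
    (hGZ : ∀ (N : ℕ) [NeZero N] (W : WeierstrassCurve ℚ) (K : Type) [Field K] [NumberField K],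
      gross_zagier N W K)
    (hKo : ∀ (N : ℕ) [NeZero N] (W : WeierstrassCurve ℚ) (K : Type) [Field K] [NumberField K],
      kolyvagin N W K)
    (hGZK : rank_eq_analyticRank_of_analyticRank_le_one) :
    CastellaGrossiLeeSkinner2022.thmF_padicValRat_bsd_rank_one :=
  RowC6.cglsThmF_of_display55_of_gvThm13 (display55_of_display54_of_thm511 h54 h511 hnf hGZ hGZK) hGV hGr
    hmodP hnf hHL hGZQ hGZ hKo hGZK

/-- **Row C6 of the partition (`r_an ≤ 1`, good Eisenstein non-anomalous `p > 2`) ⟹ `BSD(E,p)` from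
MAIN-CONJECTURE-level named facts only**: CGS Thm. A (cyclotomic, A142), CGLS Thm. 4.2.2 ∘ 5.1.3
(anticyclotomic, NEW) and Thm. 5.1.1 (control, A170), plus the generic published facts — session 4's
`RowC6.bsdp_of_display55_of_cgsThmA` with its A157 binder discharged. No `_OPEN` binder, no per-pair
binder, every odd `p`. [cite: CastellaGrossiSkinner2025, Thm. D and its proof, Theorem A]
[cite: CastellaGrossiLeeSkinner2022, Thm. 4.2.2, Thm. 5.1.1, Thm. 5.1.3, proof of Thm. 5.3.1] -/
theorem RowC6.bsdp_of_mainConjectures (h54 : display54_thm513_generator_constantCoeff)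
    (h511 : thm511_anticyclotomicControl)
    (hA : CastellaGrossiSkinner2025.thmA_charIdeal_eq_padicLFunction)
    (hGr : greenberg_charValue_rankZero) (hmodP : nonempty_modularParametrizationData)
    (hnf : exists_isNewformOf) (hHL : HoffsteinLuo1997_exists_twist_L_one_ne_zero)
    (hGZQ : GrossZagier1986_thm_I_7_3)
    (hGZ : ∀ (N : ℕ) [NeZero N] (W : WeierstrassCurve ℚ) (K : Type) [Field K] [NumberField K],
      gross_zagier N W K)
    (hKo : ∀ (N : ℕ) [NeZero N] (W : WeierstrassCurve ℚ) (K : Type) [Field K] [NumberField K],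
      kolyvagin N W K)
    (hGZK : rank_eq_analyticRank_of_analyticRank_le_one)
    (W : WeierstrassCurve ℚ) [W.IsElliptic] [W.IsGloballyMinimal] (p : ℕ) [Fact p.Prime]
    (hp : 2 < p) (hgood : Good W p) (hred : Red W p) (hna : ¬ Anom W p) (hr : W.analyticRank ≤ 1) :
    BSDp W p :=
  RowC6.bsdp_of_display55_of_cgsThmA (display55_of_display54_of_thm511 h54 h511 hnf hGZ hGZK) hA hGr hmodP
    hnf hHL hGZQ hGZ hKo hGZK W p hp hgood hred hna hr

/-- **Row vocabulary** (`RowC6 W p := 2 < p ∧ Red W p ∧ Good W p ∧ ¬ Anom W p`, `Partition/Rows.lean`):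
row C6 at `r_an ≤ 1` ⟹ `BSD(E,p)` from main-conjecture-level named facts only — the PARTITION
table's C6 entry (`RowC6.bsdp_of_mainConjectures` in the row's spelling).
[cite: CastellaGrossiSkinner2025, Thm. D and its proof, Theorem A]
[cite: CastellaGrossiLeeSkinner2022, Thm. 4.2.2, Thm. 5.1.1, Thm. 5.1.3, proof of Thm. 5.3.1] -/
theorem RowC6.bsdp_of_mainConjectures' (h54 : display54_thm513_generator_constantCoeff)
    (h511 : thm511_anticyclotomicControl)
    (hA : CastellaGrossiSkinner2025.thmA_charIdeal_eq_padicLFunction)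
    (hGr : greenberg_charValue_rankZero) (hmodP : nonempty_modularParametrizationData)
    (hnf : exists_isNewformOf) (hHL : HoffsteinLuo1997_exists_twist_L_one_ne_zero)
    (hGZQ : GrossZagier1986_thm_I_7_3)
    (hGZ : ∀ (N : ℕ) [NeZero N] (W : WeierstrassCurve ℚ) (K : Type) [Field K] [NumberField K],
      gross_zagier N W K)
    (hKo : ∀ (N : ℕ) [NeZero N] (W : WeierstrassCurve ℚ) (K : Type) [Field K] [NumberField K],
      kolyvagin N W K)
    (hGZK : rank_eq_analyticRank_of_analyticRank_le_one)
    (W : WeierstrassCurve ℚ) [W.IsElliptic] [W.IsGloballyMinimal] (p : ℕ) [Fact p.Prime]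
    (hC6 : RowC6 W p) (hr : W.analyticRank ≤ 1) : BSDp W p :=
  RowC6.bsdp_of_mainConjectures h54 h511 hA hGr hmodP hnf hHL hGZQ hGZ hKo hGZK W p hC6.1 hC6.2.2.1
    hC6.2.1 hC6.2.2.2 hr

/-! ### §4 lit-glue's (IMC∘BDP)ᵍ link at the trivial character, FED by the published fact -/

namespace X11b

variable {W : WeierstrassCurve ℚ} [W.IsElliptic] [W.IsGloballyMinimal] {p : ℕ} [Fact p.Prime]
  {K : Type} [Field K] [NumberField K]

/-- **`X11b.IMCWaldspurgerOnTreeGoodAt` FROM CGLS 2022 Thm. 4.2.2 ∘ Thm. 5.1.3** at a good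
non-anomalous Eisenstein `p > 2`, for a parametrisation with `p ∤ c_E` (then the Manin term of the
fact vanishes and its valuation is LITERALLY the predicate's): at every datum of the two theorems —
`K` imaginary quadratic with (Heeg) for `N = N_E`, (spl), (disc) `D_K` odd `≠ −3`, `ι : K ↪ ℚ_p` inducing
`v`, `v̄ ∋ p` the other (STRICT) prime, `κ` anticyclotomic with generator `γ`, `P = P_K` the Heegner
point of `(Dt, H, ιC)` non-torsion, `rank_ℤ E(K) = 1`, `#Ш(E/K)[p^∞] < ∞` — the cell's typed link
`IMCWaldspurgerOnTreeGoodAt p κ v̄ γ ι P` HOLDS, through the defeq bridge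
(`AcSelmer.hasCharValuationAt_iff_literature`, `padicLogOrd_eq_literature`). The generator with
non-zero constant term comes from Thm. 5.1.1 (A170); (Sel) from the corank theorem. Convention as in
`controlOnTreeGoodAt_of_thm511`: log at `v`, module strict at `v̄ ≠ v` (reading note
`CGLS-CTL-log-prime`). [cite: CastellaGrossiLeeSkinner2022, Thm. 4.2.2, Thm. 5.1.3, proof of Thm. 5.3.1 (5.4)]
[cite: Castella2018, §5 (eq:IMC+BDP) (arXiv:1704.06608 p. 12)] -/
theorem imcWaldspurgerOnTreeGoodAt_of_display54_of_thm511
    (h54 : display54_thm513_generator_constantCoeff) (h511 : thm511_anticyclotomicControl)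
    (hp : 2 < p) (hgood : Good W p) (hred : Red W p) (hna : ¬ Anom W p) (hK : IsImaginaryQuadratic K)
    (hodd : Odd (NumberField.discr K)) (h3 : NumberField.discr K ≠ -3)
    {N : ℕ} [NeZero N] (hN : W.conductorNorm ℤ = N) (hHN : SatisfiesHeegnerHypothesis N K)
    (hHp : SatisfiesHeegnerHypothesis p K) (ι : K →+* ℚ_[p]) (v vbar : HeightOneSpectrum (𝓞 K))
    (hv : ∀ x : 𝓞 K, x ∈ v.asIdeal ↔ ‖ι (x : K)‖ < 1)
    (hvbar : ((p : ℕ) : 𝓞 K) ∈ vbar.asIdeal) (hne : vbar ≠ v)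
    (κ : ZpExtension K p) (hκ : κ.IsAnticyclotomic)
    (γ : Field.absoluteGaloisGroup K) [Fact (κ.IsTopGenerator γ)]
    (Dt : ModularParametrizationData W N) (hc : ¬ (p : ℤ) ∣ Dt.c)
    (H : HeegnerDatum N (NumberField.discr K)) (ιC : K →+* ℂ) (P : (W.baseChange K).toAffine.Point)
    (hP : WeierstrassCurve.Affine.Point.map ιC.toRatAlgHom P = heegnerPointComplex Dt H)
    (hrk : (W.baseChange K).mordellWeilRank = 1)
    (hfinp : Finite (AddCommGroup.primaryComponent (W.baseChange K).sha p))
    (hPinf : ¬ IsOfFinAddOrder P) :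
    IMCWaldspurgerOnTreeGoodAt p κ vbar γ ι P := by
  have hHN' : SatisfiesHeegnerHypothesis (W.conductorNorm ℤ) K := by rw [hN]; exact hHN
  -- (Sel) from rank 1 and finite `Ш[p^∞]`
  have hshaK : (W.baseChange K).shaCorank p = 0 :=
    (finite_primaryComponent_sha_iff_shaCorank_eq_zero (W.baseChange K) p).mp hfinp
  have hSel : (W.baseChange K).selmerCorank p = 1 := by
    rw [(W.baseChange K).selmerCorank_eq_mordellWeilRank_add_holds p, hrk, hshaK]
  -- a generator with non-zero constant term, from Thm. 5.1.1
  have hEp : ∀ Q : (W.baseChange ℚ_[p]).toAffine.Point, p • Q = 0 → Q = 0 :=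
    LocalTorsion.localTorsion_eq_zero_of_good_of_not_anom W p (by omega) hgood hred hna
  obtain ⟨-, F, hF, hF0, -⟩ := h511 W p hp (goodOrd_of_red_of_good W p hp hgood hred) K hK hHp hHN'
    ι v vbar hv hvbar hne κ hκ γ hEp hrk hfinp P hPinf
  obtain ⟨n, hn, hval⟩ := hasCharValuationAt_of_display54 h54 hp hgood hred hna K hK hHN' hHp hodd h3
    hSel ι v vbar hv hvbar hne κ hκ γ Dt H ιC P hP F hF hF0
  have hc0 : padicValInt p Dt.c = 0 := padicValInt.eq_zero_of_not_dvd hc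
  refine ⟨n, (AcSelmer.hasCharValuationAt_iff_literature _ p κ vbar ∅ γ n).mpr hn, ?_⟩
  rw [padicLogOrd_eq_literature]
  omega

end X11b

end Summit.BirchSwinnertonDyer.Rank1Residual

end
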